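import Literature.Probability.Percolation.MarkedLoopLinkPatternLaw
import Literature.Probability.Percolation.FivePointNormalisation
import Literature.Probability.Percolation.FivePointBoundaryValues
import HarnessLib

/-!
# The generic link-pattern law at `k = 5` IS the five-point mid-edge probability (percolation side)

Topic `Literature/Probability/Percolation`; bridge between the generic-`k` loop layer (`MarkedLoops.*`: `TXb`, `InClassX`, `classCountK`,
`HobsK` of `MarkedLoopLinkPatternLaw.lean`) and the five-point files (`FivePoint.N5.*`: `loopSpace6`, `InClass`, (N) with its transport
`sixTransport_holds`). For a five-marked domain `D : TriMarkedDomain 5` and an INTERIOR face `v` (its three sites in `G`) with `i`-th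
neighbour `oppFace v i` (edge `e = {v, oppFace v i}`, dual bond `{faceVertex v (i+1), faceVertex v (i+2)}`):

* `markedLoops_hBonds_eq`, `markedLoops_isCornerFace_iff` — the two vocabularies have the same `H_G` and the same corner faces (by `rfl`);
* `TXb_eq_loopSpace6` — the generic XOR space at the edge is the five-point six-odd-point space (its endpoint face is not a corner);
* `card_filter_inClassX_eq_sum` — the class `[z ↔ y_j]` of the generic layer splits as the two five-point classes `(j, A)`, `(j, B)`
  (`N5.sixStructure_holds`: every configuration has exactly one `(j, M)`; `MarkedLoops.existsUnique_inClassX`: exactly one `j`);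
* ★ `classCountK_five_eq_card_joined` — `N_j(e) = #{T ⊆ G : e joined to y_j under reference j}` (by `N5.sixTransport_holds` and
  `N5.card_joined_split`), hence ★★ `hobsK_five_eq_midEdgeProb` — **`HobsK D v i j = midEdgeProb D j c v (oppFace v i)`** for every colour
  `c`: the loop-side partner law of `z = e` at five marks is the PERCOLATION probability that `e` is joined to `y_j` under the five-point
  boundary condition with reference `j` — the `k = 5` percolation dictionary for the generic observable; with `sum_hobsK_eq_one` this
  re-derives the tree's (N) `Σ_r midEdgeProb = 1` at interior edges (`sum_midEdgeProb_eq_one_of_linkLaw`);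
* section `AllEdges` — the same at EVERY edge of `H_G` read at a face with three `H_G`-sides (interior or boundary, corner endpoints
  allowed), through the boundary space/transport of `FivePointBoundaryValues.lean` (`Bdry.loopSpace6b` = `TXb` by `rfl`,
  `Bdry.sixStructure_gen`, `Bdry.sixTransport_b`): ★★★ `hobsK_five_eq_midEdgeProb_b`, `sum_midEdgeProb_eq_one_of_linkLaw_b`.

## References
* M. Khristoforov, S. Smirnov, *Percolation and O(1) loop model*, arXiv:2111.15612 (2021), §1.2 (arXiv v1 pp. 2–3: loop configurations
  with `k` disorders, the link pattern, Lemma 2 = the colouring ↔ loop correspondence), §2 Definition 3 (p. 4) — the `k = 5` percolation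
  dictionary itself is the lane's (FivePointNormalisation.lean, mechanism (N): transport of a disorder), not in print.

## Mathlib / tree
Tree: `FivePointNormalisation.lean` (`N5.loopSpace6`, `N5.InClass`, `N5.sixStructure_holds`, `N5.sixTransport_holds`, `N5.card_joined_split`,
`N5.midEdgeProb_eq_card_div`), `FiveMarkedLoops.lean` (`FivePoint.hBonds`, `FivePoint.IsCornerFace`, `midEdgeProb`), `MarkedLoopSpace.lean`
(`MarkedLoops.hBonds`, `MarkedLoops.IsCornerFace`, `not_corner_of_two_mem`), `KhSThreeDisorderObservable.lean` (`TXb`, `mem_loopSpaceX`,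
`InClassX`, `allSides_of_subset`), `KhSThreeDisorderNormalisation.lean` (`existsUnique_inClassX`), `TriFaceLabel.lean` (`faceEdge_oppFace`),
`TriDiscreteDomain.lean` (`hexGraph_adj_oppFace`, `faceVertex_mem`); HOME `MarkedLoopLinkPatternLaw.lean` (`classCountK`, `HobsK`, `sum_hobsK_eq_one`).
-/

open Finset

namespace Literature.Probability.Percolation.MarkedLoops

open Literature.Probability.Percolation Literature.Probability.LatticeModels
open Literature.Probability.Percolation.FivePoint (side tau xiDeg XiLinked midEdgeProb)
open TriMarkedDomain

section FiveBridge

variable (D : TriMarkedDomain 5)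

/-- the two vocabularies record the same edge set `H_G`. [cite: KhristoforovSmirnov2021, §1.2 (arXiv v1 p. 3)] -/
theorem markedLoops_hBonds_eq : hBonds D = FivePoint.hBonds D := rfl

/-- … and the same corner faces. [cite: BollobasRiordan2006, Ch. 7 §7.2.2 pp. 191–193] -/
theorem markedLoops_isCornerFace_iff (i : Fin 5) (F : HexVertex) : IsCornerFace D i F ↔ FivePoint.IsCornerFace D i F := Iff.rfl

variable {D}
variable {v : HexVertex} (hv : hexFaceVertices v ⊆ D.verts) (i : Fin 3)
include hv

/-- the two sites of the `i`-th side of an interior face lie in `G`. [folklore] -/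
private theorem faceVertex_side_mem : faceVertex v (i + 1) ∈ D.verts ∧ faceVertex v (i + 2) ∈ D.verts :=
  ⟨hv (faceVertex_mem v _), hv (faceVertex_mem v _)⟩

/-- neither face of the edge is a corner face (both contain the two sites of the side, which lie in `G`). [cite: BollobasRiordan2006, Ch. 7 §7.2.2 pp. 191–193] -/
theorem not_isCornerFace_of_mem_pair {s : HexVertex} (hs : s ∈ ({v, oppFace v i} : Finset HexVertex)) (j : Fin 5) :
    ¬ IsCornerFace D j s := by
  obtain ⟨h1, h2⟩ := faceVertex_side_mem hv i
  have hne : faceVertex v (i + 1) ≠ faceVertex v (i + 2) := fun h => by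
    have := faceVertex_injective v h
    have h3 : ∀ i : Fin 3, i + 1 ≠ i + 2 := by decide
    exact h3 i this
  rw [Finset.mem_insert, Finset.mem_singleton] at hs
  rcases hs with rfl | rfl
  · exact not_corner_of_two_mem D (faceVertex_mem _ _) (faceVertex_mem _ _) h1 h2 hne j
  · have hm1 : faceVertex v (i + 1) ∈ hexFaceVertices (oppFace v i) := by
      have : faceVertex v (i + 1) ∈ faceEdge v (oppFace v i) := by rw [faceEdge_oppFace]; simp
      exact (Finset.mem_inter.1 this).2
    have hm2 : faceVertex v (i + 2) ∈ hexFaceVertices (oppFace v i) := by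
      have : faceVertex v (i + 2) ∈ faceEdge v (oppFace v i) := by rw [faceEdge_oppFace]; simp
      exact (Finset.mem_inter.1 this).2
    exact not_corner_of_two_mem D hm1 hm2 h1 h2 hne j

/-- ★ **the generic XOR space at the edge is the five-point six-odd-point space.** [cite: KhristoforovSmirnov2021, §1.2 (arXiv v1 pp. 2–3)] -/
theorem TXb_eq_loopSpace6 {s : HexVertex} (hs : s ∈ ({v, oppFace v i} : Finset HexVertex)) :
    TXb D v i s = FivePoint.N5.loopSpace6 D (faceVertex v (i + 1)) (faceVertex v (i + 2)) s := by
  classical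
  have hnc := not_isCornerFace_of_mem_pair hv i hs
  ext ξ
  unfold TXb FivePoint.N5.loopSpace6
  rw [mem_loopSpaceX, Finset.mem_filter, Finset.mem_powerset]
  refine and_congr Iff.rfl (forall₂_congr fun F _ => ?_)
  refine iff_congr Iff.rfl ?_
  by_cases hF : F = s
  · subst hF
    have hP : ¬ ∃ j : Fin 5, IsCornerFace D j F := fun ⟨j, hj⟩ => hnc j hj
    unfold Xor
    exact ⟨fun _ => Or.inr rfl, fun _ => Or.inr ⟨rfl, hP⟩⟩
  · unfold Xor
    constructor
    · rintro (⟨hc, -⟩ | ⟨hs', -⟩)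
      · exact Or.inl hc
      · exact absurd hs' hF
    · rintro (hc | hs')
      · exact Or.inl ⟨hc, hF⟩
      · exact absurd hs' hF

omit hv in
/-- the five-point hypotheses at the edge `{v, oppFace v i}`: adjacency and the dual bond. [folklore] -/
private theorem fiveBridge_edge_facts : hexGraph.Adj v (oppFace v i) ∧
    faceEdge v (oppFace v i) = {faceVertex v (i + 1), faceVertex v (i + 2)} :=
  ⟨hexGraph_adj_oppFace v i, faceEdge_oppFace v i⟩

/-- ★ **the generic class `[z ↔ y_j]` is the union of the two five-point classes `(j, A)`, `(j, B)`.**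
[cite: KhristoforovSmirnov2021, §1.2 (arXiv v1 pp. 2–3: the link pattern)] -/
theorem inClassX_iff_exists_inClass {s : HexVertex} (hs : s ∈ ({v, oppFace v i} : Finset HexVertex))
    {ξ : Finset (Sym2 (Site 2))} (hξ : ξ ∈ TXb D v i s) (j : Fin 5) :
    InClassX D (faceVertex v (i + 1)) (faceVertex v (i + 2)) s j ξ ↔
      ∃ m : Bool, FivePoint.N5.InClass D (faceVertex v (i + 1)) (faceVertex v (i + 2)) s j m ξ := by
  obtain ⟨h1, h2⟩ := faceVertex_side_mem hv i
  obtain ⟨hadj, he⟩ := fiveBridge_edge_facts (v := v) i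
  have hξ6 : ξ ∈ FivePoint.N5.loopSpace6 D (faceVertex v (i + 1)) (faceVertex v (i + 2)) s := by
    rw [← TXb_eq_loopSpace6 hv i hs]; exact hξ
  constructor
  · intro hX
    obtain ⟨⟨j', m'⟩, hjm, -⟩ := FivePoint.N5.sixStructure_holds D v (oppFace v i) _ _ hv hadj he h1 h2 s hs ξ hξ6
    have hX' : InClassX D (faceVertex v (i + 1)) (faceVertex v (i + 2)) s j' ξ := ⟨hX.1, hjm.2.1⟩
    have hjj : j' = j :=
      (existsUnique_inClassX D (allSides_of_subset hv) i hs hξ).unique hX' hX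
    subst hjj
    exact ⟨m', hjm⟩
  · rintro ⟨m, hm⟩
    exact ⟨hξ, hm.2.1⟩

open Classical in
/-- ★ **class counts: `#[z ↔ y_j] = #(j, A) + #(j, B)`** on each half of the edge. [cite: KhristoforovSmirnov2021, §1.2 (arXiv v1 pp. 2–3)] -/
theorem card_filter_inClassX_eq_sum {s : HexVertex} (hs : s ∈ ({v, oppFace v i} : Finset HexVertex)) (j : Fin 5) :
    #((TXb D v i s).filter fun ξ => InClassX D (faceVertex v (i + 1)) (faceVertex v (i + 2)) s j ξ) =
      #((FivePoint.N5.loopSpace6 D (faceVertex v (i + 1)) (faceVertex v (i + 2)) s).filter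
          fun ξ => FivePoint.N5.InClass D (faceVertex v (i + 1)) (faceVertex v (i + 2)) s j false ξ) +
        #((FivePoint.N5.loopSpace6 D (faceVertex v (i + 1)) (faceVertex v (i + 2)) s).filter
          fun ξ => FivePoint.N5.InClass D (faceVertex v (i + 1)) (faceVertex v (i + 2)) s j true ξ) := by
  obtain ⟨h1, h2⟩ := faceVertex_side_mem hv i
  obtain ⟨hadj, he⟩ := fiveBridge_edge_facts (v := v) i
  set W := FivePoint.N5.loopSpace6 D (faceVertex v (i + 1)) (faceVertex v (i + 2)) s with hW
  have hTW : TXb D v i s = W := TXb_eq_loopSpace6 hv i hs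
  -- the two five-point classes are disjoint (uniqueness of the pair `(j, M)`)
  have hdisj : Disjoint (W.filter fun ξ => FivePoint.N5.InClass D (faceVertex v (i + 1)) (faceVertex v (i + 2)) s j false ξ)
      (W.filter fun ξ => FivePoint.N5.InClass D (faceVertex v (i + 1)) (faceVertex v (i + 2)) s j true ξ) := by
    rw [Finset.disjoint_filter]
    intro ξ hξW hA hB
    obtain ⟨p, -, huniq⟩ := FivePoint.N5.sixStructure_holds D v (oppFace v i) _ _ hv hadj he h1 h2 s hs ξ hξW
    have e1 := huniq (j, false) hA
    have e2 := huniq (j, true) hB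
    have : (j, false) = (j, true) := e1.trans e2.symm
    simp at this
  rw [← Finset.card_union_of_disjoint hdisj]
  congr 1
  ext ξ
  simp only [Finset.mem_filter, Finset.mem_union]
  constructor
  · rintro ⟨hξT, hX⟩
    have hξW : ξ ∈ W := hTW ▸ hξT
    obtain ⟨m, hm⟩ := (inClassX_iff_exists_inClass hv i hs hξT j).1 hX
    cases m
    · exact Or.inl ⟨hξW, hm⟩
    · exact Or.inr ⟨hξW, hm⟩
  · rintro (⟨hξW, hm⟩ | ⟨hξW, hm⟩)
    · have hξT : ξ ∈ TXb D v i s := hTW ▸ hξW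
      exact ⟨hξT, (inClassX_iff_exists_inClass hv i hs hξT j).2 ⟨false, hm⟩⟩
    · have hξT : ξ ∈ TXb D v i s := hTW ▸ hξW
      exact ⟨hξT, (inClassX_iff_exists_inClass hv i hs hξT j).2 ⟨true, hm⟩⟩

open Classical in
/-- ★ **`N_j(e) = #{T ⊆ G : e joined to y_j under reference j}`** (the five-point transport, both halves of the edge, both link patterns).
[cite: KhristoforovSmirnov2021, §1.2 (arXiv v1 pp. 2–3), five-disorder analogue (the lane's (N) transport)] -/
theorem classCountK_five_eq_card_joined (c : Bool) (j : Fin 5) :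
    classCountK D v i j = #(D.verts.powerset.filter fun T : Finset (Site 2) =>
      FivePoint.Joined D (↑T : Set (Site 2)) j c v ∨ FivePoint.Joined D (↑T : Set (Site 2)) j c (oppFace v i)) := by
  obtain ⟨h1, h2⟩ := faceVertex_side_mem hv i
  obtain ⟨hadj, he⟩ := fiveBridge_edge_facts (v := v) i
  have hT := FivePoint.N5.sixTransport_holds D v (oppFace v i) _ _ hv hadj he h1 h2 c j
  have hA := hT false
  have hB := hT true
  simp only [Bool.false_eq_true, if_false] at hA
  simp only [if_true] at hB
  rw [FivePoint.N5.card_joined_split, ← hA, ← hB]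
  unfold classCountK
  rw [card_filter_inClassX_eq_sum hv i (by simp) j, card_filter_inClassX_eq_sum hv i (by simp) j]
  ring

/-- ★★ **the generic partner law at `k = 5` IS the five-point mid-edge probability**: `HobsK D v i j = midEdgeProb D j c v (oppFace v i)`
for every colour `c` — the loop probability that the strand from `z = e` ends at `y_j` equals the probability, under critical site
percolation with the five-point boundary condition of reference `j`, that `e` is joined to `y_j` off the interfaces.
[cite: KhristoforovSmirnov2021, §1.2 Lemma 2 (arXiv v1 pp. 2–3), five-disorder analogue] -/
theorem hobsK_five_eq_midEdgeProb (c : Bool) (j : Fin 5) : HobsK D v i j = midEdgeProb D j c v (oppFace v i) := by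
  unfold HobsK
  rw [FivePoint.N5.midEdgeProb_eq_card_div, classCountK_five_eq_card_joined hv i c j]

/-- **(N) at interior edges re-derived from the generic link-pattern law** (`sum_hobsK_eq_one` with `Odd 5`).
[cite: KhristoforovSmirnov2021, §1.2 (arXiv v1 p. 3), five-disorder analogue] -/
theorem sum_midEdgeProb_eq_one_of_linkLaw (c : Bool) : ∑ r : Fin 5, midEdgeProb D r c v (oppFace v i) = 1 := by
  have h := sum_hobsK_eq_one D (by decide) (allSides_of_subset hv) i
  simpa only [hobsK_five_eq_midEdgeProb hv i c] using h

end FiveBridge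

/-! ### Every edge of `H_G` read at a valence-3 face (interior OR boundary, corner endpoints allowed)

The boundary six-point space `Bdry.loopSpace6b` of `FivePointBoundaryValues.lean` is LITERALLY the generic XOR space, and its structure /
transport theorems (`Bdry.sixStructure_gen`, `Bdry.sixTransport_b`) hold at every edge of `H_G` whose bond has an endpoint in `G`; so the
identity `HobsK = midEdgeProb` extends from interior edges to every side of a face with three `H_G`-sides. -/

section AllEdges

variable {D : TriMarkedDomain 5} {v : HexVertex} (hv : AllSides D v) (i : Fin 3)
include hv

omit hv in
/-- the generic XOR space IS the boundary six-point space of `FivePointBoundaryValues.lean` (same definition). [cite: KhristoforovSmirnov2021, §1.2 (arXiv v1 p. 2)] -/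
theorem TXb_eq_loopSpace6b (s : HexVertex) :
    TXb D v i s = FivePoint.Bdry.loopSpace6b D (faceVertex v (i + 1)) (faceVertex v (i + 2)) s := rfl

/-- an endpoint of the `i`-th side in `G`, presented as `faceEdge v (oppFace v i) = {g, o}` with `g ∈ G`, together with the matching
presentation of the XOR space. [folklore] -/
private theorem exists_faceEdge_presentation : ∃ g o : Site 2, faceEdge v (oppFace v i) = {g, o} ∧ g ∈ D.verts ∧
    ∀ s, TXb D v i s = FivePoint.Bdry.loopSpace6b D g o s := by
  have hb : side v i ∈ hBonds D := hv i
  obtain ⟨a, b, hab, ha, -⟩ := exists_rep_of_mem_hBonds D hb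
  have hside : side v i = s(faceVertex v (i + 1), faceVertex v (i + 2)) := rfl
  rw [hside] at hab
  rcases Sym2.eq_iff.1 hab with ⟨h1, h2⟩ | ⟨h1, h2⟩
  · refine ⟨faceVertex v (i + 1), faceVertex v (i + 2), faceEdge_oppFace v i, h1 ▸ ha, fun s => rfl⟩
  · refine ⟨faceVertex v (i + 2), faceVertex v (i + 1), by rw [faceEdge_oppFace, Finset.pair_comm], h2 ▸ ha, fun s => ?_⟩
    show loopSpaceX D (faceVertex v (i + 1)) (faceVertex v (i + 2)) s = _
    rw [loopSpaceX_comm]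
    rfl

/-- the generic class is the union of the two boundary classes, at every `H_G`-edge read at a valence-3 face. [cite: KhristoforovSmirnov2021, §1.2 (arXiv v1 p. 2)] -/
theorem inClassX_iff_exists_inClassb {g o : Site 2} (he : faceEdge v (oppFace v i) = {g, o}) (hg : g ∈ D.verts)
    (hsp : ∀ s, TXb D v i s = FivePoint.Bdry.loopSpace6b D g o s)
    {s : HexVertex} (hs : s ∈ ({v, oppFace v i} : Finset HexVertex)) {ξ : Finset (Sym2 (Site 2))} (hξ : ξ ∈ TXb D v i s) (j : Fin 5) :
    InClassX D (faceVertex v (i + 1)) (faceVertex v (i + 2)) s j ξ ↔ ∃ m : Bool, FivePoint.Bdry.InClassb D g o s j m ξ := by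
  have hξb : ξ ∈ FivePoint.Bdry.loopSpace6b D g o s := by rw [← hsp s]; exact hξ
  constructor
  · intro hX
    obtain ⟨⟨j', m'⟩, hjm, -⟩ := FivePoint.Bdry.sixStructure_gen (D := D) (hexGraph_adj_oppFace v i) he hg hs hξb
    have hX' : InClassX D (faceVertex v (i + 1)) (faceVertex v (i + 2)) s j' ξ := ⟨hX.1, hjm.2.1⟩
    have hjj : j' = j := (existsUnique_inClassX D hv i hs hξ).unique hX' hX
    subst hjj
    exact ⟨m', hjm⟩
  · rintro ⟨m, hm⟩
    exact ⟨hξ, hm.2.1⟩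

open Classical in
/-- class counts at every `H_G`-edge read at a valence-3 face: `#[z ↔ y_j] = #(j, A) + #(j, B)`. [cite: KhristoforovSmirnov2021, §1.2 (arXiv v1 p. 2)] -/
theorem card_filter_inClassX_eq_sum_b {g o : Site 2} (he : faceEdge v (oppFace v i) = {g, o}) (hg : g ∈ D.verts)
    (hsp : ∀ s, TXb D v i s = FivePoint.Bdry.loopSpace6b D g o s)
    {s : HexVertex} (hs : s ∈ ({v, oppFace v i} : Finset HexVertex)) (j : Fin 5) :
    #((TXb D v i s).filter fun ξ => InClassX D (faceVertex v (i + 1)) (faceVertex v (i + 2)) s j ξ) =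
      #((FivePoint.Bdry.loopSpace6b D g o s).filter fun ξ => FivePoint.Bdry.InClassb D g o s j false ξ) +
        #((FivePoint.Bdry.loopSpace6b D g o s).filter fun ξ => FivePoint.Bdry.InClassb D g o s j true ξ) := by
  set W := FivePoint.Bdry.loopSpace6b D g o s with hW
  have hTW : TXb D v i s = W := hsp s
  have hdisj : Disjoint (W.filter fun ξ => FivePoint.Bdry.InClassb D g o s j false ξ)
      (W.filter fun ξ => FivePoint.Bdry.InClassb D g o s j true ξ) := by
    rw [Finset.disjoint_filter]
    intro ξ hξW hA hB
    obtain ⟨p, -, huniq⟩ := FivePoint.Bdry.sixStructure_gen (D := D) (hexGraph_adj_oppFace v i) he hg hs hξW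
    have : (j, false) = (j, true) := (huniq (j, false) hA).trans (huniq (j, true) hB).symm
    simp at this
  rw [← Finset.card_union_of_disjoint hdisj]
  congr 1
  ext ξ
  simp only [Finset.mem_filter, Finset.mem_union]
  constructor
  · rintro ⟨hξT, hX⟩
    have hξW : ξ ∈ W := hTW ▸ hξT
    obtain ⟨m, hm⟩ := (inClassX_iff_exists_inClassb hv i he hg hsp hs hξT j).1 hX
    cases m
    · exact Or.inl ⟨hξW, hm⟩
    · exact Or.inr ⟨hξW, hm⟩
  · rintro (⟨hξW, hm⟩ | ⟨hξW, hm⟩)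
    · have hξT : ξ ∈ TXb D v i s := hTW ▸ hξW
      exact ⟨hξT, (inClassX_iff_exists_inClassb hv i he hg hsp hs hξT j).2 ⟨false, hm⟩⟩
    · have hξT : ξ ∈ TXb D v i s := hTW ▸ hξW
      exact ⟨hξT, (inClassX_iff_exists_inClassb hv i he hg hsp hs hξT j).2 ⟨true, hm⟩⟩

open Classical in
/-- ★ **`N_j(e) = #{T ⊆ G : e joined to y_j under reference j}` at EVERY edge of `H_G` read at a valence-3 face.**
[cite: KhristoforovSmirnov2021, §1.2 (arXiv v1 p. 2), five-disorder analogue (the lane's boundary transport N3∂)] -/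
theorem classCountK_five_eq_card_joined_b (c : Bool) (j : Fin 5) :
    classCountK D v i j = #(D.verts.powerset.filter fun T : Finset (Site 2) =>
      FivePoint.Joined D (↑T : Set (Site 2)) j c v ∨ FivePoint.Joined D (↑T : Set (Site 2)) j c (oppFace v i)) := by
  obtain ⟨g, o, he, hg, hsp⟩ := exists_faceEdge_presentation hv i
  have hT := FivePoint.Bdry.sixTransport_b (D := D) (hexGraph_adj_oppFace v i) he hg c j
  have hA := hT false
  have hB := hT true
  simp only [Bool.false_eq_true, if_false] at hA
  simp only [if_true] at hB
  rw [FivePoint.N5.card_joined_split, ← hA, ← hB]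
  unfold classCountK
  rw [card_filter_inClassX_eq_sum_b hv i he hg hsp (by simp) j, card_filter_inClassX_eq_sum_b hv i he hg hsp (by simp) j]
  ring

/-- ★★★ **THE k = 5 DICTIONARY FOR THE GENERIC OBSERVABLE, EVERY EDGE**: at every side of a face with three `H_G`-sides of a five-marked
domain (interior or boundary, corner endpoints allowed), `HobsK D v i j = midEdgeProb D j c v (oppFace v i)` for every colour `c`.
[cite: KhristoforovSmirnov2021, §1.2 Lemma 2 (arXiv v1 pp. 2–3), five-disorder analogue] -/
theorem hobsK_five_eq_midEdgeProb_b (c : Bool) (j : Fin 5) : HobsK D v i j = midEdgeProb D j c v (oppFace v i) := by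
  unfold HobsK
  rw [FivePoint.N5.midEdgeProb_eq_card_div, classCountK_five_eq_card_joined_b hv i c j]

/-- **(N) at every `H_G`-edge read at a valence-3 face, from the generic link-pattern law.** [cite: KhristoforovSmirnov2021, §1.2 (arXiv v1 p. 2), five-disorder analogue] -/
theorem sum_midEdgeProb_eq_one_of_linkLaw_b (c : Bool) : ∑ r : Fin 5, midEdgeProb D r c v (oppFace v i) = 1 := by
  have h := sum_hobsK_eq_one D (by decide) hv i
  simpa only [hobsK_five_eq_midEdgeProb_b hv i c] using h

end AllEdges

end Literature.Probability.Percolation.MarkedLoops
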